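import Summits.BirchSwinnertonDyer.BirchSwinnertonDyer.Theses.ErratumRoadFive
import Summits.BirchSwinnertonDyer.BirchSwinnertonDyer.Theorems.ErratumRoadFiveControlFromJSWMult
import Summits.BirchSwinnertonDyer.Rank1Residual.X11b.BDPRouteOpenInputFromLever
import Summits.BirchSwinnertonDyer.BirchSwinnertonDyer.Theorems.ErratumRoadFiveRest3SlackRungs
import Summits.BirchSwinnertonDyer.BirchSwinnertonDyer.Theorems.ErratumRoadFiveRest3TorsionBranchB
import Summits.BirchSwinnertonDyer.BirchSwinnertonDyer.Theorems.ErratumRoadFiveRest3BranchesOfGuardedB12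

/-! **v3 (bsd-stepL-imc-p1 g29, 2026-08-29, executing planner g44's RULING 93 (2)):** the citable fact leaf F1 `stub_t_castellaPNewDisplay`
(JIMJ18 Thms. 2.10–2.11) is now the ROUTE ITEM `Theses.ErratumRoadFive.CastellaPNewDisplayInput` (aside stmt-BirchSwinnertonDyer-23913, ER5 rev 71,
unfolds definitionally to `Castella2018Exceptional.thm210_thm211_bdpDisplay_pNew`) taken BY NAME as the binder `hJ` of `Rest3TorsionBranchAtFive_of` ∕
`_proof` (RULING 82 (b): «a printed theorem is an ITEM BY NAME, not a stub»); the F1 decl and its `Statement` abbrev are removed, NOTHING ELSE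
CHANGES: S1′ `stub_t_imcDivSomeFrameBne3`, S2 `stub_t_regulatorNonvanishing`, R1 `stub_rung_t_5190r1` (closed BY NAME p475167, inactive), F2
`stub_t_leverFacts` (the K2@3 routes' lever items, not yet ER5 items; used by `Rest3TorsionBranchAtFive_of_regulator` only) and both compositions are
v2 VERBATIM. Registered open content after v3: S1′ (line 1) ∕ S2 (line 2); binders BY NAME: `PublishedInputsFive` (19066), `JSWAnticyclotomicControlMult`
(19626), `CastellaPNewDisplayInput` (23913). No summit statement and no crux is proved here; BSD is not advanced by this file.

**v2 (bsd-stepL-bdp g24, 2026-08-27, executing planner g37's RULING 36 (α)):** the deciding stub S1 is now the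
GUARDED B-atom `stub_t_imcDivSomeFrameBne3` — the body of `P2.IMCDivSomeFrameOnTreeB W p` on the (T) rows with ONE extra
binder `NumberField.discr K ≠ -3` right after `Odd (NumberField.discr K)` (BCS25's (disc) order; PROOF-BDP 57.12 ∕ §60:
neither UB (§43) nor the BCS25 anchor of ROAD B12 serves `K = ℚ(√−3)`, admissible at `p ≥ 5`); the composition
`Rest3TorsionBranchAtFive_of` still concludes the crux BY NAME, now through ONE-SIDED TIGHTNESS on (ram) (bdp g24
p563393 `Rest3GuardedB12.rest3TorsionBranchAtFive_of_imcDivSomeFrameB_guarded_of_pNew_of_thm331Mult`: guarded atom ⟹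
`Typed.MissingLowerBoundAt` through a Hoffstein–Luo field with `|d_K| > 4` (p561251 §8) ⟹ `P2OpenInputOnTreeAt` at EVERY
field by `openInputOnTreeAt_of_missingLowerBoundAt_of_ram_of_thm331Mult`), so it takes the route's support item
`JSWAnticyclotomicControlMult` (19626) as a second registered hypothesis. S1's by-name resolution into ROAD B12's sources
is LANDED: p563393 §11 `…_of_thm124b_of_upperDivisibility_of_transfer_of_thm331Mult` (⟸ {Hsieh 5.6, BDP 5.5, BCS25
1.2.4 (b) + 4.2.2, JIMJ18, JSW 3.3.1-mult, PublishedInputsFive} + UB♯|ᵍ|T + TRANSFER|ᵍ|T, both memo-proved, PROOF-BDP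
§55 ∕ §40 ∕ §37.11 ∕ §58). S2, R1, F1, F2 and `Rest3TorsionBranchAtFive_of_regulator` are v1 VERBATIM.

BC3 birth skeleton v1 (REGISTERED FORM, concludes the route decl BY NAME) for crux `Rest3TorsionBranchAtFive` =
item stmt-BirchSwinnertonDyer-19702 (K2 `ErratumRoadFive` rev 14; child (T) of 19624 REST‴, planner g25's split
13:24:45Z over seat rest-p2's `@[conjecture]` def p446621): route p2's open input `P2OpenInputOnTreeAt W p` at
every (ram) pair with a NON-ZERO `p`-torsion point in `E(ℚ_p)` — class-wide 3 687 pairs (`N < 5·10⁵`, `p ≥ 5`;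
ALL split at `p` with `p ∣ v_p(Δ_min) = c_p`, `p ∈ {5, 7, 11, 13}`; CENSUS-REST3-BRANCHES.md, kit j254731).
Seat `bsd-stepL-rest-p2` (prover g0, 2026-08-26), drafted at planner g25's request (STATUS 13:24:45Z); the
planner registers it (`ledger skeleton check … --crux stmt-BirchSwinnertonDyer-19702`). Registered form:
named stubs `stub_*` (sorries ONLY there), stub statements by name (`Statement.stub_*` via `type_of%`), the
composition `Rest3TorsionBranchAtFive_of` concluding the ROUTE DECL by name (sorry-free), and
`Rest3TorsionBranchAtFive_proof`.

TWO GENUINE INPUTS, TWO TECHNIQUES (either ALONE gives the crux together with named facts; the skeleton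
registers both and composes the crux along the first, the K2 route's own currency; the named facts not yet bound
by the route enter as the CITABLE fact-stubs F1 ∕ F2 — `ledger skeleton check` requires every hypothesis of the
composition to be a registered obligation or a declared stub):
* `stub_t_imcDivSomeFrameB` — **the IMC-some-frame road, RE-ORIENTED v2B** (bdp g16 p498117 ∕ p498588
  `Rest3TorsionBranchB.rest3TorsionBranchAtFive_of_imcDivSomeFrameB_of_pNew`): (2.4)∃♭ `P2.IMCDivSomeFrameOnTreeB W p` — ONE inclusion
  `Ch_Λ(X_ac(E[p^∞])) ⊆ (Q)` of the anticyclotomic main conjecture for SOME BDP frame at the classical Heegner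
  data of the pair — asked ONLY on the (T) rows. No road in print (BCS25 Thm. 1.2.4 good ordinary; FW21
  Thm. 4.41 ∕ Castella 2024 Thm. 3.1 (iii) need a non-split `E[p]`-ramified `q`; erratum (iv) fails here by
  definition); the value at `𝟙` is PRINT (JIMJ18 Thms. 2.10–2.11, reviewed fact `thm210_thm211_bdpDisplay_pNew`).
* `stub_t_regulatorNonvanishing` — **the cyclotomic LEVER road** (class-closure, multr1 ∕ x11b gens 18–21):
  Schneider's non-degeneracy `ClassClosure.RegulatorNonvanishingAt W p` (THE canonical `p`-adic height is
  non-degenerate — at a SPLIT `p` the Stein–Wuthrich split-canonical datum) asked ONLY on the (T) rows. Every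
  other input of this road is PUBLISHED (Skinner 2016 Thm. A cyclotomic IMC at a multiplicative `p` with (ram),
  Stein–Wuthrich 2013 Thm. 6.1 + §4.2, Disegni 2020 Thm. 1, GZK, modular parametrisation ⟹ `BSD(E,p)` by
  `ClassClosure.bsdp_of_leverLocus_of_regulatorNonvanishing` — «any `#Ш_an`; no Tamagawa, Heegner-index,
  anticyclotomic or image hypothesis»; then multr1-p2's tightness `P2.openInputOnTreeAt_of_bsdp_of_ram` with
  the Jetchev–Skinner–Wan control fact). Class-wide OPEN since 1985 (Schneider); PER PAIR a finite `p`-adic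
  computation (`ellpadicheight` at a split multiplicative `p`) — so every (T) pair is a certificate candidate
  modulo PRINT ONLY (composition `Rest3TorsionBranchAtFive_of_regulator`).
* `stub_rung_t_5190r1` — PLAN-ONLY BC5 rung: the open input at the single (T) pair `(5190r1, 5)`, the (T) row
  of smallest SEMISTABLE conductor `N ≥ 5000` (the smallest (T) row overall, `5130g1`, `N = 5130 = 2·3³·5·19`,
  is additive at `3`).

Why the parent's instruments stop on (T): the erratum road needs (iv); Kolyvagin's index certificate and
SZ14♯ need `p ∤ [E(K):ℤy_K]`, impossible when `p ∣ c_p` (Gross–Zagier carries the Tamagawa factor — seat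
rest-p2's 5595f1 numbers, RUNG-5015b1-CERT.md §2); what remains is an IMC inclusion (stub 1) or a `p`-adic
height (stub 2). Census of the (T) rows by carrier: `p` only 3 419, `p` and another split `ℓ` 268
(REST4-CENSUS.md); lane ledger: 3 348 ∕ 3 687 `literal` on the flagged `JET@p|N` reading, 3 `proved`.

Pair data for the rung (multr1-p1 census + seat rest-p2 kit j254731 ∕ j254852; zero compute here): `5190r1 =
[1, 0, 0, −9535, 307097]`, `y² + xy = x³ − 9535x + 307097`, `N = 5190 = 2·3·5·173` (semistable; `≥ 5000`: outside
Miller 2011 ∕ Creutz–Miller 2012 ∕ Lawson–Wuthrich 2016), `Δ = 14528678400000 = 2¹²·3⁸·5⁵·173`,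
`c₄ = 457681 = 7·151·433` (`gcd(Δ, c₄) = 1`: minimal), split multiplicative at `2, 3, 5, 173` with
`c = 12, 8, 5, 1` (`∏ c_ℓ = 480`), `r_an = 1`, `ρ̄_{E,5}` surjective; at `p = 5`: SPLIT, `v₅(Δ_min) = 5 = c₅`, and the
unit part of the Tate parameter is a `5`-th power (`u₀⁴ ≡ 1 mod 25`; three independent tests, kit j254731) so
`E(ℚ₅)[5] ≅ ℤ/5` — a (T) pair; (ram) witnesses `2, 3, 173` (`5 ∤ 12, 8, 1`), all SPLIT, so NO erratum prime;
carrier of `5` in `∏c`: `5` only. Technique for the rung: the REG certificate (canonical `5`-adic height of a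
generator ≠ 0) + the lever (all published) ⟹ `BSD(E,5)` ⟹ the open input by tightness + JSW control; the
Heegner-index certificate is EXCLUDED here (`5 ∣ c₅ ∣ [E(K):ℤy_K]`).

[cite: Castella2018Erratum, Thm. 1.1 (iv), (2.4)] [cite: Castella2018Exceptional, Thms. 2.10–2.11]
[cite: Skinner2016PacificMC, Thm. A and Thm. C] [cite: SteinWuthrich2013, Thm. 6.1, §4.2]
[cite: Disegni2020, Thm. 1] [cite: Schneider1982PadicHeightI, §1] [cite: JetchevSkinnerWan2017, Thm. 3.3.1, §7.4]
[cite: Cremona1997, Table 1 (curves 5190r1, 5130g1)]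
-/

-- D-0017: single-problem summit, the namespace repeats the problem name by design.
set_option linter.dupNamespace false

noncomputable section

open scoped Classical

namespace Summit.BirchSwinnertonDyer.BirchSwinnertonDyer.Cruxes.Rest3TorsionBranchAtFive.Birth

open Literature.NumberTheory.EllipticCurves Literature.NumberTheory.EllipticCurves.ModularForms
  Literature.NumberTheory.EllipticCurves.Rank1Residual
  Literature.NumberTheory.EllipticCurves.Castella2018Exceptional
  Literature.NumberTheory.EllipticCurves.SteinWuthrich2013
  Literature.NumberTheory.EllipticCurves.Disegni2020
  Literature.NumberTheory.EllipticCurves.Skinner2016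
  Summit.BirchSwinnertonDyer.Rank1Residual Summit.BirchSwinnertonDyer.Rank1Residual.X11b
  Summit.BirchSwinnertonDyer.BirchSwinnertonDyer.Theses.ErratumRoadFive
  Summit.BirchSwinnertonDyer.BirchSwinnertonDyer.Theorems

/-! The crux decl is the ROUTE decl `Summit.BirchSwinnertonDyer.BirchSwinnertonDyer.Theses.ErratumRoadFive.Rest3TorsionBranchAtFive`
(item stmt-BirchSwinnertonDyer-19702, ErratumRoadFive rev 14) := the Theses-free constant
`Summit.BirchSwinnertonDyer.BirchSwinnertonDyer.Theorems.Rest3TorsionBranchAtFive` (p446621). -/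

/-! ## Registered stubs -/

/-- **S1 · `stub_t_imcDivSomeFrameBne3` — (2.4)∃♭ ON THE (T) ROWS, RE-ORIENTED AND GUARDED (v2; RULING 36 (α)).** The body of
the B-atom `P2.IMCDivSomeFrameOnTreeB W p` (bsd-stepL-bdp g16 p498117: divisibility read at the prime 𝔭bar ≠ 𝔭_{ι′} CONJUGATE
to the frame prime) VERBATIM, with ONE extra binder `NumberField.discr K ≠ -3` after `Odd (NumberField.discr K)`, asked at
every (ram) pair with a non-zero `p`-torsion point in `E(ℚ_p)`: for every classical Heegner datum over an admissible
`K ≠ ℚ(√−3)` SOME BDP frame `(Ω_K, Ω_p, Q)` with Castella's interpolation property has `Ch_Λ(X_ac(E[p^∞]) 𝔭bar)·𝓞_{ℂ_p}⟦T⟧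
⊆ (Q)` at every X-slot `𝔭bar ≠ 𝔭_{ι′}`. No printed derivation at these data; ROAD B12 (λ-matching transfer with a
good-ordinary `p`-congruent partner, BCS25 Thm 1.2.4 (b) anchor) resolves it into UB♯ + TRANSFER (p563393 §11).
[cite: Castella2018Erratum, (2.4) (p. 4) (display transcribed; nothing asserted)] [cite: Castella2018, Thm. 3.1 (shape of the frame)]
[cite: BurungaleCastellaSkinner2025, §1.2 (disc) (arXiv:2405.00270v2 p. 2) (why `d_K ≠ −3`)] -/
theorem stub_t_imcDivSomeFrameBne3 :
    ∀ (W : WeierstrassCurve ℚ) [W.IsElliptic] [W.IsGloballyMinimal] (p : ℕ) [Fact p.Prime],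
      Literature.NumberTheory.EllipticCurves.Rank1Residual.Ram W p →
      (∃ P : (W.baseChange ℚ_[p]).toAffine.Point, p • P = 0 ∧ P ≠ 0) →
      ∀ (N : ℕ) [NeZero N] (K : Type) [Field K] [NumberField K]
        (Dt : Literature.NumberTheory.EllipticCurves.ModularForms.ModularParametrizationData W N)
        (H : Literature.NumberTheory.EllipticCurves.HeegnerDatum N (NumberField.discr K)) (ι : K →+* ℂ)
        (P : (W.baseChange K).toAffine.Point),
        Summit.BirchSwinnertonDyer.Rank1Residual.ClassX11b W p → 5 ≤ p →
        Literature.NumberTheory.EllipticCurves.Rank1Residual.Surj W p → W.conductorNorm ℤ = N →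
        Literature.NumberTheory.EllipticCurves.IsImaginaryQuadratic K →
        Odd (NumberField.discr K) → NumberField.discr K ≠ -3 → ¬ (p : ℤ) ∣ NumberField.discr K →
        ¬ p ∣ NumberField.Units.torsionOrder K →
        Literature.NumberTheory.EllipticCurves.SatisfiesHeegnerHypothesis N K →
        (W.quadraticTwist (NumberField.discr K : ℚ)).entireLFunction 1 ≠ 0 →
        WeierstrassCurve.Affine.Point.map ι.toRatAlgHom P =
          Literature.NumberTheory.EllipticCurves.ModularForms.heegnerPointComplex Dt H →
        ¬ (p : ℤ) ∣ Dt.c → ¬ IsOfFinAddOrder P →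
        ∀ (κ : Literature.NumberTheory.EllipticCurves.ZpExtension K p), κ.IsAnticyclotomic →
          ∀ (γ : Field.absoluteGaloisGroup K) [Fact (κ.IsTopGenerator γ)]
            (ι' : PadicAlgCl p ≃+* ℂ) (w₀ : NumberField.InfinitePlace K)
            (P' : (W.baseChange K).toAffine.Point),
            WeierstrassCurve.Affine.Point.map w₀.embedding.toRatAlgHom P' =
              Literature.NumberTheory.EllipticCurves.ModularForms.heegnerPointComplex Dt H →
            ∀ (e : K →+* ℚ_[p]),
              (∀ k : NumberField.RingOfIntegers K,
                k ∈ (Summit.BirchSwinnertonDyer.Rank1Residual.X11b.primeOfEmbeddingDatum p ι' w₀.embedding).asIdeal ↔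
                  ‖e (k : K)‖ < 1) →
              ∃ (ΩK : ℂ) (Ωp : ℂ_[p]) (Q : PowerSeries 𝓞_ℂ_[p]), ΩK ≠ 0 ∧ ‖Ωp‖ = 1 ∧
                Summit.BirchSwinnertonDyer.Rank1Residual.X11b.R1.IsBDPLFunctionInt p ι'
                  (Summit.BirchSwinnertonDyer.Rank1Residual.X11b.primeOfEmbeddingDatum p ι' w₀.embedding) κ γ Dt.f ΩK Ωp Q ∧
                ∀ (𝔭bar : IsDedekindDomain.HeightOneSpectrum (NumberField.RingOfIntegers K)),
                  ((p : ℕ) : NumberField.RingOfIntegers K) ∈ 𝔭bar.asIdeal →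
                  𝔭bar ≠ Summit.BirchSwinnertonDyer.Rank1Residual.X11b.primeOfEmbeddingDatum p ι' w₀.embedding →
                  (Summit.BirchSwinnertonDyer.Rank1Residual.X11b.AcSelmer.XAc.charIdeal (W.baseChange K) p κ 𝔭bar ∅ γ).map
                      (PowerSeries.map (Summit.BirchSwinnertonDyer.Rank1Residual.X11b.R1.toCpInt p)) ≤
                    Ideal.span {Q} := by
  sorry

/-- **S2 · `stub_t_regulatorNonvanishing` — SCHNEIDER NON-DEGENERACY ON THE (T) ROWS (the cyclotomic lever road).**
At every X11b pair with `p ≥ 5`, a (ram) witness and a non-zero `p`-torsion point in `E(ℚ_p)` (so `p` SPLIT,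
`p ∣ v_p(Δ_min) = c_p`): THE canonical `p`-adic height is non-degenerate (`ClassClosure.RegulatorNonvanishingAt`: for
the Stein–Wuthrich split-canonical datum `IsSplitMultCanonical Dh Dq`, `padicRegulator Dh ≠ 0`; the non-split
clause is vacuous here). Class-wide = Schneider's conjecture (open); per pair a finite `p`-adic computation.
[cite: Schneider1982PadicHeightI, §1] [cite: SteinWuthrich2013, §4.2 and Conj. 4.1] -/
theorem stub_t_regulatorNonvanishing :
    ∀ (W : WeierstrassCurve ℚ) [W.IsElliptic] [W.IsGloballyMinimal] (p : ℕ) [Fact p.Prime],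
      Summit.BirchSwinnertonDyer.Rank1Residual.ClassX11b W p → 5 ≤ p →
      Literature.NumberTheory.EllipticCurves.Rank1Residual.Ram W p →
      (∃ P : (W.baseChange ℚ_[p]).toAffine.Point, p • P = 0 ∧ P ≠ 0) →
      Summit.BirchSwinnertonDyer.Rank1Residual.X11b.ClassClosure.RegulatorNonvanishingAt W p := by
  sorry

/-- **R1 · `stub_rung_t_5190r1` — PLAN-ONLY BC5 RUNG, v2 (seat rest-p2 g2, 2026-08-27): BY-NAME CERTIFICATE SHAPE ON THE
TAMAGAWA-SLACK ROAD.** The open input at the single (T) pair `(5190r1, 5)` (`N = 5190 = 2·3·5·173 ≥ 5000` semistable, SPLIT at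
`5` with `v₅(Δ) = c₅ = 5` and `E(ℚ₅)[5] ≠ 0`, `∏ c_ℓ = 480`, `ρ̄₅` onto, `r_an = 1`) from the route's published support items
`PublishedInputsFive` + `JSWAnticyclotomicControlMult` and ONE attested Tamagawa-SLACK Heegner datum over `ℚ(√−431)` (`h = 21`,
`β = 407`, `y_K ≡ 240·g`, `#E(K)_tors = 2`, `ord₅ [E(K):ℤy_K] = 1 ≤ 1 = ord₅ ∏ c_ℓ`; seat g2 kit j261919) — NO `p`-adic regulator,
NO lever fact, NO preprint (v1's regulator-road theorem `Theorems.rung_5190r1_of_regCert`, p453225, stands as the second road).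
Closed by name by `Theorems.rung_5190r1_d431_of_items_of_slackCert` (p475167). [cite: Cremona1997, Table 1 (5190r1)]
[cite: Gross1991, (1.1), (2.2)] [cite: JetchevSkinnerWan2017, Thm. 3.3.1, §7.4.1] [cite: Kolyvagin1990, Thm. A] -/
theorem stub_rung_t_5190r1
    [((⟨1, 0, 0, -9535, 307097⟩ : WeierstrassCurve ℤ).baseChange ℚ).IsElliptic] [((⟨1, 0, 0, -9535, 307097⟩ : WeierstrassCurve ℤ).baseChange ℚ).IsGloballyMinimal] [NeZero (((⟨1, 0, 0, -9535, 307097⟩ : WeierstrassCurve ℤ).baseChange ℚ).conductorNorm ℤ)]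
    (hF : Summit.BirchSwinnertonDyer.BirchSwinnertonDyer.Theses.ErratumRoadFive.PublishedInputsFive)
    (h331 : Summit.BirchSwinnertonDyer.BirchSwinnertonDyer.Theses.ErratumRoadFive.JSWAnticyclotomicControlMult)
    (K : Type) [Field K] [NumberField K] (hK : Literature.NumberTheory.EllipticCurves.IsImaginaryQuadratic K)
    (hdK : NumberField.discr K = -431)
    (hH : Literature.NumberTheory.EllipticCurves.SatisfiesHeegnerHypothesis (((⟨1, 0, 0, -9535, 307097⟩ : WeierstrassCurve ℤ).baseChange ℚ).conductorNorm ℤ) K)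
    (Dt : Literature.NumberTheory.EllipticCurves.ModularForms.ModularParametrizationData ((⟨1, 0, 0, -9535, 307097⟩ : WeierstrassCurve ℤ).baseChange ℚ) (((⟨1, 0, 0, -9535, 307097⟩ : WeierstrassCurve ℤ).baseChange ℚ).conductorNorm ℤ))
    (H : Literature.NumberTheory.EllipticCurves.HeegnerDatum (((⟨1, 0, 0, -9535, 307097⟩ : WeierstrassCurve ℤ).baseChange ℚ).conductorNorm ℤ) (NumberField.discr K))
    (ι : K →+* ℂ) (P : (((⟨1, 0, 0, -9535, 307097⟩ : WeierstrassCurve ℤ).baseChange ℚ).baseChange K).toAffine.Point)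
    (hP : WeierstrassCurve.Affine.Point.map ι.toRatAlgHom P =
      Literature.NumberTheory.EllipticCurves.ModularForms.heegnerPointComplex Dt H)
    (hc : ¬ (5 : ℤ) ∣ Dt.c) (hnt : ¬ IsOfFinAddOrder P)
    (hidx : padicValNat 5 (AddSubgroup.zmultiples P).index ≤ 1) :
    Summit.BirchSwinnertonDyer.Rank1Residual.X11b.P2OpenInputOnTreeAt
      ((⟨1, 0, 0, -9535, 307097⟩ : WeierstrassCurve ℤ).baseChange ℚ) 5 := by
  sorry

/-- **F2 · `stub_t_leverFacts` — CITABLE FACT BUNDLE (not a genuine stub): the PUBLISHED inputs of the cyclotomic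
lever** — Skinner 2016 Thm. A (cyclotomic IMC at a multiplicative `p` with (ram)), Stein–Wuthrich 2013 Thm. 6.1
(non-split ∕ split) and §4.2 (existence of the canonical heights), Disegni 2020 Thm. 1 (`p`-adic BSD in analytic
rank one at a multiplicative `p`), modular parametrisation — each a Literature named fact BY NAME (they are the
support items `PublishedInputs…` of the K2@3 routes; not yet bound by `ErratumRoadFive`). Used only by the
alternative composition `Rest3TorsionBranchAtFive_of_regulator`. [cite: Skinner2016PacificMC, Thm. A (§1)]
[cite: SteinWuthrich2013, Thm. 6.1 (p. 20), §4.2] [cite: Disegni2020, Thm. 1 (§1.2)] -/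
theorem stub_t_leverFacts :
    Literature.NumberTheory.EllipticCurves.Skinner2016.thmA_charIdeal_multiplicative ∧
      Literature.NumberTheory.EllipticCurves.SteinWuthrich2013.thm61_nonsplitMultiplicative ∧
      Literature.NumberTheory.EllipticCurves.SteinWuthrich2013.thm61_splitMultiplicative ∧
      Literature.NumberTheory.EllipticCurves.SteinWuthrich2013.exists_isMultCanonical ∧
      Literature.NumberTheory.EllipticCurves.SteinWuthrich2013.exists_isSplitMultCanonical ∧
      Literature.NumberTheory.EllipticCurves.Disegni2020.thm1_padicBSD_rankOne_multiplicative ∧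
      Literature.NumberTheory.EllipticCurves.ModularForms.nonempty_modularParametrizationData := by
  sorry

/-! ## Stub statements by name -/

namespace Statement

/-- Statement of `stub_t_imcDivSomeFrameBne3` (v2, guarded). -/
abbrev stub_t_imcDivSomeFrameBne3 : Prop := type_of% @Birth.stub_t_imcDivSomeFrameBne3
/-- Statement of `stub_t_regulatorNonvanishing`. -/
abbrev stub_t_regulatorNonvanishing : Prop := type_of% @Birth.stub_t_regulatorNonvanishing
/-- Statement of `stub_rung_t_5190r1` (plan-only BC5 rung; not used by `Rest3TorsionBranchAtFive_of`). -/
abbrev stub_rung_t_5190r1 : Prop := type_of% @Birth.stub_rung_t_5190r1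
/-- Statement of `stub_t_leverFacts` (citable fact bundle; used by `Rest3TorsionBranchAtFive_of_regulator` only). -/
abbrev stub_t_leverFacts : Prop := type_of% @Birth.stub_t_leverFacts

end Statement

/-! ## The compositions (sorry-free): each genuine stub STATEMENT, with named facts, implies the crux BY NAME -/

/-- **`Rest3TorsionBranchAtFive_of`** (v3 = v2 with the F1 leaf ↦ the item binder `hJ`) — the crux (T) BY NAME from the GUARDED S1 +
the route's published-input support item `PublishedInputsFive` (19066) + its JSW control item `JSWAnticyclotomicControlMult` (19626) + its
JIMJ18 item `CastellaPNewDisplayInput` (23913): bsd-stepL-bdp g24's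
`Rest3GuardedB12.rest3TorsionBranchAtFive_of_imcDivSomeFrameB_guarded_of_pNew_of_thm331Mult` (p563393: guarded atom ⟹
`Typed.MissingLowerBoundAt` through ONE Hoffstein–Luo field with `|d_K| > 4`, then one-sided tightness on (ram) ⟹ `P2OpenInputOnTreeAt`
at EVERY field; off `ClassX11b ∧ 5 ≤ p` vacuous). Pure composition.
[cite: Castella2018Exceptional, Thms. 2.10–2.11 (arXiv:1507.04260 pp. 13–14)] [cite: Castella2018Erratum, (2.4) (p. 4)]
[cite: JetchevSkinnerWan2017, Thm. 3.3.1 with §3.5 (3.5.c)] [cite: HoffsteinLuo1997, Theorem] -/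
theorem Rest3TorsionBranchAtFive_of (hF : PublishedInputsFive) (h331 : JSWAnticyclotomicControlMult)
    (hJ : CastellaPNewDisplayInput) (h1 : Statement.stub_t_imcDivSomeFrameBne3) :
    Summit.BirchSwinnertonDyer.BirchSwinnertonDyer.Theses.ErratumRoadFive.Rest3TorsionBranchAtFive := by
  obtain ⟨hGZ, hKo, -, hSk, hWu, hGZK, hmod, hnf, hHL, -, hMaz, -, -, hPT, hEP⟩ := hF
  exact Summit.BirchSwinnertonDyer.BirchSwinnertonDyer.Theorems.Rest3GuardedB12.rest3TorsionBranchAtFive_of_imcDivSomeFrameB_guarded_of_pNew_of_thm331Mult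
    h331 hGZ hKo hSk hWu hGZK hmod hnf hMaz hHL hPT hEP hJ h1

/-- **`Rest3TorsionBranchAtFive_of_regulator`** — the crux (T) BY NAME from S2 ALONE plus PUBLISHED named facts:
`PublishedInputsFive` (19066: Gross–Zagier, Kolyvagin, Skinner 2016 Thm. C, GZK, modularity),
`JSWAnticyclotomicControlMult` (19626: the control identity, `p2ControlOnTreeAt_of_thm331Mult`), and the lever's
facts (Skinner 2016 Thm. A `hSkA`, Stein–Wuthrich Thm. 6.1 `hJn hJs` + §4.2 `hHn hHs`, Disegni Thm. 1 `hD`,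
parametrisation `hpar`). At a (T) pair, inside the predicate's binders (`ClassX11b`, `5 ≤ p`), the lever
`ClassClosure.bsdp_of_leverLocus_of_regulatorNonvanishing` turns S2 into `BSD(E,p)` and multr1-p2's tightness
`P2.openInputOnTreeAt_of_bsdp_of_ram` turns `BSD(E,p)` into the open input. Sorry-free; registers S2 as a genuine
alternative input (no preprint anywhere on this road). [cite: Skinner2016PacificMC, Thm. A and Thm. C (§1)]
[cite: SteinWuthrich2013, Thm. 6.1 (p. 20), §4.2] [cite: Disegni2020, Thm. 1 (§1.2)]
[cite: JetchevSkinnerWan2017, Thm. 3.3.1, §7.4.1] [cite: Schneider1982PadicHeightI, §1] -/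
theorem Rest3TorsionBranchAtFive_of_regulator (hF : PublishedInputsFive) (h331 : JSWAnticyclotomicControlMult)
    (hL : Statement.stub_t_leverFacts) (h2 : Statement.stub_t_regulatorNonvanishing) :
    Summit.BirchSwinnertonDyer.BirchSwinnertonDyer.Theses.ErratumRoadFive.Rest3TorsionBranchAtFive := by
  obtain ⟨hGZ, hKo, -, hSk, -, hGZK, hmod, -, -, -, -, -, -, -, -⟩ := hF
  obtain ⟨hSkA, hJn, hJs, hHn, hHs, hD, hpar⟩ := hL
  intro W _ _ p _ hram hP
  refine p2OpenInputOnTreeAt_of_imp_surj W p fun hX hp5 _ ↦ ?_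
  exact P2.openInputOnTreeAt_of_bsdp_of_ram W p hGZ hKo hSk hGZK hmod (p2ControlOnTreeAt_of_thm331Mult W p h331 hKo)
    hram
    (ClassClosure.bsdp_of_leverLocus_of_regulatorNonvanishing W p hSkA hJn hJs hHn hHs hD hGZK hpar hX
      (ClassClosure.leverLocusAt_of_ram_of_five_le W p hram hp5) (h2 W p hX hp5 hram hP))

/-- The crux along this line — v3: MODULO exactly the registered stub S1 (v2, guarded) and the route items it is composed with
(sorries live only in `stub_*`; `PublishedInputsFive` (19066), `JSWAnticyclotomicControlMult` (19626) and `CastellaPNewDisplayInput` (23913)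
are the route's items, registered obligations, taken as hypotheses exactly as `closes` takes them). -/
theorem Rest3TorsionBranchAtFive_proof (hF : PublishedInputsFive) (h331 : JSWAnticyclotomicControlMult)
    (hJ : CastellaPNewDisplayInput) :
    Summit.BirchSwinnertonDyer.BirchSwinnertonDyer.Theses.ErratumRoadFive.Rest3TorsionBranchAtFive :=
  Rest3TorsionBranchAtFive_of hF h331 hJ stub_t_imcDivSomeFrameBne3

end Summit.BirchSwinnertonDyer.BirchSwinnertonDyer.Cruxes.Rest3TorsionBranchAtFive.Birth

end
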